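import Literature.Computability.MetaComplexity.EFPlainAssoc
import Literature.Computability.MetaComplexity.EFModAddUMFI
import Literature.Computability.MetaComplexity.EFLayout
import HarnessLib

/-!
# Plain ripple-carry arithmetic: the middle-four interchange `(a + b) + (c + d) ≡ (a + c) + (b + d)`

Layer P/2. A KIT of fourteen `W`-bit ripple-carry adders (carry-ins false, carries above `W`
discarded) — the six canonical sums `AB, CD, AC, BD, S1 = AB + CD, S2 = AC + BD` (pieces
`0 … 5`) and eight intermediate ones — and the law `Plain.MFI.isBlock_lines` concluding
`S1.sᵢ ↔ S2.sᵢ`, by the chain `(a+b)+(c+d) ≡ a+(b+(c+d))`,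
`b+(c+d) ≡ (b+c)+d ≡ (c+b)+d ≡ c+(b+d)`, `a+(c+(b+d)) ≡ (a+c)+(b+d)` (associativity `PASSOC`,
commutativity, congruences).

## Sources

* S. A. Cook, R. A. Reckhow, *The relative efficiency of propositional proof systems*,
  J. Symbolic Logic 44 (1979), §2.
* H. Vollmer, *Introduction to Circuit Complexity* (Springer 1999), §1.2.
-/

namespace Literature.Computability.MetaComplexity

open _root_.Computability Complexity Complexity.PropForm Netlist Cluster FregeSystem

namespace Plain

namespace MFI

variable (W : ℕ)

/-- Length of an adder. [folklore] -/
def A (W : ℕ) : ℕ := 2 * W + 1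

/-- An operand reference: input word at `m · W` (`inl`) or the sum word of piece `m` (`inr`). [folklore] -/
def oref : Bool × ℕ → ℕ → ℕ ⊕ ℕ
  | (false, m), j => Sum.inl (m * W + j)
  | (true, m), j => Sum.inr (m * A W + (2 * j + 1))

/-- The operands of the fourteen adders: `AB, CD, AC, BD, S1, S2, BC1, T21, BCp, T1p, CB, T1pp, T2pp, T3`. [folklore] -/
def ops (k : ℕ) : (Bool × ℕ) × (Bool × ℕ) :=
  [((false, 0), (false, 1)), ((false, 2), (false, 3)), ((false, 0), (false, 2)), ((false, 1), (false, 3)),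
    ((true, 0), (true, 1)), ((true, 2), (true, 3)), ((false, 1), (true, 1)), ((false, 0), (true, 6)),
    ((false, 1), (false, 2)), ((true, 8), (false, 3)), ((false, 2), (false, 1)), ((true, 10), (false, 3)),
    ((false, 2), (true, 3)), ((false, 0), (true, 12))].getD k ((false, 0), (false, 0))

/-- The wiring of adder `k`. [folklore] -/
def wire (k : ℕ) (j : ℕ) : ℕ ⊕ ℕ := if j < W then oref W (ops k).1 j else oref W (ops k).2 (j - W)

/-- The pieces: fourteen adders. [cite: Vollmer1999, §1.2] -/
def pieces (W : ℕ) (k : ℕ) : Piece := ⟨Adder.addT false W, 2 * W, wire W k⟩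

/-- **The interchange kit.** [cite: Vollmer1999, §1.2] -/
def mfiT (W : ℕ) : Template := layout (pieces W) 14

/-- Offsets. [folklore] -/
theorem offset_pieces (k : ℕ) : offset (pieces W) k = k * A W := by
  induction k with
  | zero => simp
  | succ k ih => rw [offset_succ, ih]; simp [pieces, A]; ring

/-- The operand references are well formed: inputs below `4W`, sum words of earlier pieces. [folklore] -/
theorem ops_ok : ∀ k < 14, ((ops k).1.1 = false → (ops k).1.2 ≤ 3) ∧ ((ops k).1.1 = true → (ops k).1.2 < k) ∧
    ((ops k).2.1 = false → (ops k).2.2 ≤ 3) ∧ ((ops k).2.1 = true → (ops k).2.2 < k) := by decide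

/-- A reference is in range. [folklore] -/
theorem oref_ok {k : ℕ} {r : Bool × ℕ} (h : (r.1 = false → r.2 ≤ 3) ∧ (r.1 = true → r.2 < k)) {j : ℕ} (hj : j < W) :
    (∀ a, oref W r j = Sum.inl a → a < 4 * W) ∧ (∀ g, oref W r j = Sum.inr g → g < k * A W) := by
  obtain ⟨b, m⟩ := r
  cases b
  · have hm : m ≤ 3 := h.1 rfl
    refine ⟨fun a ha => ?_, fun g hg => ?_⟩
    · simp only [oref] at ha; cases ha; nlinarith
    · simp [oref] at hg
  · have hm : m < k := h.2 rfl
    refine ⟨fun a ha => ?_, fun g hg => ?_⟩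
    · simp [oref] at ha
    · simp only [oref] at hg; cases hg
      have : (m + 1) * A W ≤ k * A W := Nat.mul_le_mul_right _ hm
      unfold A at this ⊢; nlinarith

/-- Every piece is well formed and well wired (`4W` inputs). [cite: Vollmer1999, Def. 1.6] -/
theorem piece_ok : ∀ k < 14, Piece.OK (pieces W) (4 * W) k := by
  intro k hk
  refine ⟨Adder.wf_addT false W, fun j hj => ?_⟩
  rw [offset_pieces]
  show (∀ a, wire W k j = Sum.inl a → a < 4 * W) ∧ (∀ g, wire W k j = Sum.inr g → g < k * A W)
  have hj' : j < 2 * W := hj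
  obtain ⟨h1, h2, h3, h4⟩ := ops_ok k hk
  unfold wire; split_ifs with hjW
  · exact oref_ok W ⟨h1, h2⟩ hjW
  · exact oref_ok W ⟨h3, h4⟩ (by omega)

/-- **The kit is well formed** (`4W` inputs). [cite: Vollmer1999, Def. 1.6] -/
theorem wf_mfiT : (mfiT W).WF (4 * W) := wf_layout (pieces W) (piece_ok W)

/-! ### Views -/

section Views

variable (o : Occ)

/-- The word referenced by an operand reference. [folklore] -/
def oword : Bool × ℕ → ℕ → ℕ
  | (false, m), j => o.inp (m * W + j)
  | (true, m), j => o.base + (m * A W + (2 * j + 1))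

/-- The adder view of piece `k`. [folklore] -/
def V (k : ℕ) : Adder.View := ⟨o.base + k * A W, oword W o (ops k).1, oword W o (ops k).2⟩

/-- All fourteen adders are available. [folklore] -/
def MAvail (K : PropForm ℕ) (Γ : Set (PropForm ℕ)) : Prop := ∀ k < 14, (V W o k).Avail K Γ false W

end Views

variable {W} {o : Occ} {K : PropForm ℕ} {Γ : Set (PropForm ℕ)} {G : FregeSystem}

/-- References resolve to words. [folklore] -/
theorem ref_oref {k : ℕ} {r : Bool × ℕ} (h : (r.1 = false → r.2 ≤ 3) ∧ (r.1 = true → r.2 < k)) {j : ℕ} (hj : j < W) :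
    (o.inst (4 * W)).ref (oref W r j) = oword W o r j := by
  obtain ⟨b, m⟩ := r
  cases b
  · have hm : m ≤ 3 := h.1 rfl
    exact Occ.ref_inl o (by show m * W + j < 4 * W; nlinarith)
  · rw [oref, Occ.ref_inr]; rfl

/-- The sum bits of piece `m` are the word `oword (true, m)`. [folklore] -/
theorem s_V (m i : ℕ) : (V W o m).s i = oword W o (true, m) i := by
  simp [V, oword, Adder.View.s, Adder.View.wire, Nat.add_assoc]

/-- **All adders of an available occurrence are available.** [folklore] -/
theorem avail_ofOcc (ho : o.Avail (mfiT W) (4 * W) K Γ) : MAvail W o K Γ := by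
  intro k hk
  obtain ⟨h1, h2, h3, h4⟩ := ops_ok k hk
  have hq : (pieceOcc (o.inst (4 * W)) (pieces W) k).Avail (Adder.addT false W) (2 * W) K Γ := Inst.DefsAvail.piece ho hk (Adder.wf_addT false W)
  refine Adder.View.Avail.congr (Adder.avail_viewOf hq) ?_ (fun i hi => ?_) (fun i hi => ?_)
  · show o.base + k * A W = (pieceOcc (o.inst (4 * W)) (pieces W) k).base; simp [pieceOcc, offset_pieces]
  · show oword W o (ops k).1 i = ((pieceOcc (o.inst (4 * W)) (pieces W) k).inst (2 * W)).inputs.getD i 0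
    rw [Occ.getD_inst _ (show i < 2 * W by omega)]
    show _ = (o.inst (4 * W)).ref (wire W k i)
    unfold wire; rw [if_pos hi, ref_oref ⟨h1, h2⟩ hi]
  · show oword W o (ops k).2 i = ((pieceOcc (o.inst (4 * W)) (pieces W) k).inst (2 * W)).inputs.getD (W + i) 0
    rw [Occ.getD_inst _ (show W + i < 2 * W by omega)]
    show _ = (o.inst (4 * W)).ref (wire W k (W + i))
    unfold wire; rw [if_neg (by omega), Nat.add_sub_cancel_left, ref_oref ⟨h3, h4⟩ hi]

/-! ### The law -/

section Segs

variable (W : ℕ) (o : Occ) (K : PropForm ℕ)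

/-- The sum word of piece `m`. [folklore] -/
def S (m : ℕ) (i : ℕ) : ℕ := oword W o (true, m) i

/-- The segments of the interchange law. [folklore] -/
def segs : List (List (PropForm ℕ)) :=
  [Adder.reflLines K ((List.range W).map (oword W o (false, 0)) ++ (List.range W).map (oword W o (false, 1)) ++
      (List.range W).map (oword W o (false, 2)) ++ (List.range W).map (oword W o (false, 3))),   -- 0
   (⟨V W o 0, V W o 4, V W o 6, V W o 7⟩ : AssocData).lines K W,      -- 1: (a+b)+CD ≡ a+(b+CD): S4 ≡ S7
   (⟨V W o 8, V W o 9, V W o 1, V W o 6⟩ : AssocData).lines K W,      -- 2: (b+c)+d ≡ b+(c+d): S9 ≡ S6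
   Adder.commLines (V W o 8) (V W o 10) K W,                          -- 3: b+c ≡ c+b (all wires)
   Adder.leibLines (V W o 9) (V W o 11) K W,                          -- 4: (b+c)+d ≡ (c+b)+d: wires 9 ≡ 11
   (⟨V W o 10, V W o 11, V W o 3, V W o 12⟩ : AssocData).lines K W,   -- 5: (c+b)+d ≡ c+(b+d): S11 ≡ S12
   ModAddU.MFI.symmLines K (S W o 9) (S W o 6) W,                     -- 6: S6 ≡ S9
   ModAddU.MFI.transLines K (S W o 6) (S W o 11) W,                   -- 7: S6 ≡ S11
   ModAddU.MFI.transLines K (S W o 6) (S W o 12) W,                   -- 8: S6 ≡ S12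
   Adder.leibLines (V W o 7) (V W o 13) K W,                          -- 9: a+(S6) ≡ a+(S12): wires 7 ≡ 13
   (⟨V W o 2, V W o 5, V W o 12, V W o 13⟩ : AssocData).lines K W,   -- 10: (a+c)+BD ≡ a+(c+BD): S5 ≡ S13
   ModAddU.MFI.transLines K (S W o 4) (S W o 13) W,                   -- 11: S4 ≡ S13 (via S7)
   ModAddU.MFI.symmLines K (S W o 5) (S W o 13) W,                    -- 12: S13 ≡ S5
   ModAddU.MFI.transLines K (S W o 4) (S W o 5) W]                    -- 13: S4 ≡ S5

/-- **The lines of the interchange law.** [folklore] -/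
def lines : List (PropForm ℕ) := (segs W o K).flatten

end Segs

/-- The length of the segment list. [folklore] -/
theorem length_segs (W : ℕ) (o : Occ) (K : PropForm ℕ) : (segs W o K).length = 14 := rfl

/-- **The middle-four interchange of ripple-carry addition inside Frege.** For an available
occurrence of the interchange kit, `S1.sᵢ ↔ S2.sᵢ`: `(a + b) + (c + d) ≡ (a + c) + (b + d)`
bitwise (carries above `W` discarded on both sides). [cite: CookReckhow1979, §2] -/
theorem isBlock_lines (hGP : ∀ r ∈ rules, r ∈ G.rules) (hGN : ∀ r ∈ Netlist.rules, r ∈ G.rules) (hGA : ∀ r ∈ Adder.rules, r ∈ G.rules)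
    (hGL : ∀ r ∈ Logic.rules, r ∈ G.rules) (h : MAvail W o K Γ) : G.IsBlock Γ (lines W o K) := by
  refine ModAddU.AssocData.isBlock_flatten _ fun k hk => ?_
  rw [length_segs] at hk
  have mem : ∀ {χ} (j : ℕ) (hj : j < k) (hχ : χ ∈ (segs W o K)[j]'(by rw [length_segs]; omega)),
      χ ∈ Γ ∪ {χ | ∃ j, ∃ hj : j < k, χ ∈ (segs W o K)[j]'(by rw [length_segs]; omega)} := fun j hj hχ => Or.inr ⟨j, hj, hχ⟩
  have hΓ : Γ ⊆ Γ ∪ {χ | ∃ j, ∃ hj : j < k, χ ∈ (segs W o K)[j]'(by rw [length_segs]; omega)} := fun _ hχ => Or.inl hχ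
  have mr : ∀ {f : ℕ → PropForm ℕ} {i : ℕ}, i < W → f i ∈ (List.range W).map f := fun hi => List.mem_map.2 ⟨_, List.mem_range.2 hi, rfl⟩
  have av := fun (m : ℕ) (hm : m < 14) => (h m hm).mono hΓ
  have rf : 0 < k → ∀ (m : ℕ), m ≤ 3 → ∀ i < W, ctx K (eqv (oword W o (false, m) i) (oword W o (false, m) i)) ∈
      Γ ∪ {χ | ∃ j, ∃ hj : j < k, χ ∈ (segs W o K)[j]'(by rw [length_segs]; omega)} := by
    intro hk0 m hm i hi
    refine mem 0 hk0 (Adder.mem_reflLines ?_)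
    simp only [List.mem_append, List.mem_map, List.mem_range]
    interval_cases m
    · exact Or.inl (Or.inl (Or.inl ⟨i, hi, rfl⟩))
    · exact Or.inl (Or.inl (Or.inr ⟨i, hi, rfl⟩))
    · exact Or.inl (Or.inr ⟨i, hi, rfl⟩)
    · exact Or.inr ⟨i, hi, rfl⟩
  -- sum bits of the assoc conclusions as `S` words
  have sS : ∀ m i, (V W o m).s i = S W o m i := fun m i => s_V m i
  have mA : ∀ {a b c e : ℕ} (j : ℕ) (hj : j < k) (eq : (segs W o K)[j]'(by rw [length_segs]; omega) = (⟨V W o a, V W o b, V W o c, V W o e⟩ : AssocData).lines K W)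
      {i : ℕ} (hi : i < W), ctx K (eqv (S W o b i) (S W o e i)) ∈ Γ ∪ {χ | ∃ j, ∃ hj : j < k, χ ∈ (segs W o K)[j]'(by rw [length_segs]; omega)} := by
    intro a b c e j hj eq i hi
    have := (⟨V W o a, V W o b, V W o c, V W o e⟩ : AssocData).mem_lines (K := K) hi
    rw [sS, sS] at this
    exact mem j hj (by rw [eq]; exact this)
  interval_cases k
  · exact Adder.isBlock_reflLines hGA _ _ _
  · exact (⟨V W o 0, V W o 4, V W o 6, V W o 7⟩ : AssocData).isBlock_lines hGP (av 0 (by omega)) (av 4 (by omega)) (av 6 (by omega)) (av 7 (by omega))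
      (fun i hi => (sS 0 i).symm) (fun i hi => rfl) (fun i hi => rfl) (fun i hi => rfl) (fun i hi => (sS 6 i).symm)
  · exact (⟨V W o 8, V W o 9, V W o 1, V W o 6⟩ : AssocData).isBlock_lines hGP (av 8 (by omega)) (av 9 (by omega)) (av 1 (by omega)) (av 6 (by omega))
      (fun i hi => (sS 8 i).symm) (fun i hi => rfl) (fun i hi => rfl) (fun i hi => rfl) (fun i hi => (sS 1 i).symm)
  · exact Adder.isBlock_commLines hGN hGA _ _ (av 8 (by omega)) (av 10 (by omega)) (fun i hi => rf (by omega) 1 (by omega) i hi) (fun i hi => rf (by omega) 2 (by omega) i hi)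
  · refine Adder.isBlock_leibLines hGN _ _ (av 9 (by omega)) (av 11 (by omega)) (fun i hi => ?_) (fun i hi => rf (by omega) 3 le_rfl i hi)
    have := Adder.mem_commLines (P := V W o 8) (Q := V W o 10) (K := K) (W := W) (k := 2 * i + 1) (by omega)
    rw [show (V W o 8).wire (2 * i + 1) = S W o 8 i from sS 8 i, show (V W o 10).wire (2 * i + 1) = S W o 10 i from sS 10 i] at this
    exact mem 3 (by omega) this
  · exact (⟨V W o 10, V W o 11, V W o 3, V W o 12⟩ : AssocData).isBlock_lines hGP (av 10 (by omega)) (av 11 (by omega)) (av 3 (by omega)) (av 12 (by omega))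
      (fun i hi => (sS 10 i).symm) (fun i hi => rfl) (fun i hi => rfl) (fun i hi => rfl) (fun i hi => (sS 3 i).symm)
  · exact ModAddU.MFI.isBlock_symmLines hGL K fun i hi => mA 2 (by omega) rfl hi
  · refine ModAddU.MFI.isBlock_transLines hGL K (fun i hi => mem 6 (by omega) (mr hi)) fun i hi => ?_
    have := Adder.mem_leibLines (P := V W o 9) (Q := V W o 11) (K := K) (W := W) (k := 2 * i + 1) (by omega)
    rw [show (V W o 9).wire (2 * i + 1) = S W o 9 i from sS 9 i, show (V W o 11).wire (2 * i + 1) = S W o 11 i from sS 11 i] at this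
    exact mem 4 (by omega) this
  · exact ModAddU.MFI.isBlock_transLines hGL K (fun i hi => mem 7 (by omega) (mr hi)) fun i hi => mA 5 (by omega) rfl hi
  · exact Adder.isBlock_leibLines hGN _ _ (av 7 (by omega)) (av 13 (by omega)) (fun i hi => rf (by omega) 0 (by omega) i hi) (fun i hi => mem 8 (by omega) (mr hi))
  · exact (⟨V W o 2, V W o 5, V W o 12, V W o 13⟩ : AssocData).isBlock_lines hGP (av 2 (by omega)) (av 5 (by omega)) (av 12 (by omega)) (av 13 (by omega))
      (fun i hi => (sS 2 i).symm) (fun i hi => rfl) (fun i hi => rfl) (fun i hi => rfl) (fun i hi => (sS 12 i).symm)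
  · refine ModAddU.MFI.isBlock_transLines hGL K (fun i hi => mA 1 (by omega) rfl hi) fun i hi => ?_
    have := Adder.mem_leibLines (P := V W o 7) (Q := V W o 13) (K := K) (W := W) (k := 2 * i + 1) (by omega)
    rw [show (V W o 7).wire (2 * i + 1) = S W o 7 i from sS 7 i, show (V W o 13).wire (2 * i + 1) = S W o 13 i from sS 13 i] at this
    exact mem 9 (by omega) this
  · exact ModAddU.MFI.isBlock_symmLines hGL K fun i hi => mA 10 (by omega) rfl hi
  · exact ModAddU.MFI.isBlock_transLines hGL K (fun i hi => mem 11 (by omega) (mr hi)) fun i hi => mem 12 (by omega) (mr hi)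

/-- **The conclusion of the interchange law**: `S1.sᵢ ↔ S2.sᵢ`. [folklore] -/
theorem mem_lines {i : ℕ} (hi : i < W) : ctx K (eqv ((V W o 4).s i) ((V W o 5).s i)) ∈ lines W o K := by
  have h14 : (segs W o K).length = 14 := rfl
  rw [s_V, s_V]
  exact List.mem_flatten.2 ⟨_, List.getElem_mem (n := 13) (by omega), List.mem_map.2 ⟨i, List.mem_range.2 hi, rfl⟩⟩

/-- **Size of the interchange law**: `≤ 24 (W+1) (|K| + 130)`. [folklore] -/
theorem proofSize_lines (W : ℕ) (o : Occ) (K : PropForm ℕ) : proofSize (lines W o K) ≤ 24 * ((W + 1) * (K.size + 130)) := by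
  have hK := Nat.zero_le K.size
  have hR : proofSize (Adder.reflLines K ((List.range W).map (oword W o (false, 0)) ++ (List.range W).map (oword W o (false, 1)) ++
      (List.range W).map (oword W o (false, 2)) ++ (List.range W).map (oword W o (false, 3)))) ≤ 4 * ((W + 1) * (K.size + 130)) := by
    rw [Adder.proofSize_reflLines]; simp only [List.length_append, List.length_map, List.length_range]; nlinarith
  have hA : ∀ (a b c e : ℕ), proofSize ((⟨V W o a, V W o b, V W o c, V W o e⟩ : AssocData).lines K W) ≤ 2 * ((W + 1) * (K.size + 130)) :=
    fun a b c e => ((⟨V W o a, V W o b, V W o c, V W o e⟩ : AssocData).proofSize_lines K W).trans (by nlinarith)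
  have hC : proofSize (Adder.commLines (V W o 8) (V W o 10) K W) ≤ 2 * ((W + 1) * (K.size + 130)) :=
    (Adder.proofSize_commLines (V W o 8) (V W o 10) K W).trans (by nlinarith)
  have hL : ∀ (P Q : Adder.View), proofSize (Adder.leibLines P Q K W) ≤ 2 * ((W + 1) * (K.size + 130)) :=
    fun P Q => (Adder.proofSize_leibLines P Q K W).trans (by nlinarith)
  have hT : ∀ (u w : ℕ → ℕ), proofSize ((List.range W).map fun i => ctx K (eqv (u i) (w i))) ≤ (W + 1) * (K.size + 130) :=
    fun u w => (proofSize_map_range_le (s := K.size + 10) fun i _ => by simp [ctx, eqv, size, FregeSystem.size_biimp]).trans (by nlinarith)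
  have e : lines W o K = (segs W o K).flatten := rfl
  rw [e]
  simp only [segs, List.flatten_cons, List.flatten_nil, proofSize_append, List.append_nil]
  have t6 := hT (fun i => S W o 6 i) (fun i => S W o 9 i)
  have t7 := hT (S W o 6) (S W o 11)
  have t8 := hT (S W o 6) (S W o 12)
  have t11 := hT (S W o 4) (S W o 13)
  have t12 := hT (fun i => S W o 13 i) (fun i => S W o 5 i)
  have t13 := hT (S W o 4) (S W o 5)
  unfold ModAddU.MFI.transLines ModAddU.MFI.symmLines
  linarith [hR, hA 0 4 6 7, hA 8 9 1 6, hC, hL (V W o 9) (V W o 11), hA 10 11 3 12, hL (V W o 7) (V W o 13), hA 2 5 12 13]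

end MFI

end Plain

end Literature.Computability.MetaComplexity
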